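import Summits.QuantumFields.YangMills.Theorems.UnitScaleTiltProp7CmapTwSReadSet
import Literature.MathematicalPhysics.QuantumFieldTheory.Balaban1983to89.B10StarCount
import HarnessLib

/-!
# Route `UnitScaleTilt`, crux «MinimiserStabilityRegPr» (stmt-QuantumFields-19200, stub EX `stub_existenceMinimalOrbit`), route (α) —
# **THE COARSE COLUMN OF THE KERNEL `𝔇(A; c, b) = (δ∕δA(b))C(U₀, A)(c)` OF THE CHART OF RECORD HAS AT MOST `2d = 6` NON-ZERO ENTRIES, SO ANY PER-ENTRY LETTER `M` GIVES THE
# COLUMN LETTER `6·M`** (piece (P3) of LOCATE «W6» px18 g2: zero off the read set by ✓`Prop7CmapTwSReadSet` + counting; the per-entry letter is DISPLAYED — the operator-norm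
# instance from ✓`inputs_CmapTwS`'s `deriv_le` is recorded as the per-lattice corollary, NOT the k-uniform (157)-twˢ letter, see HONEST SCOPE)

Cell `ym3-torus` (HUMAN RULING D-0037, YM ladder rung R3 — YM₃ on T³ is a rung, NOT d = 4, NOT a mass gap, NOT Clay), width seat `ym3-torus-px18` (gen 2).
THEOREMS ONLY (0 `def`, 0 `sorry`); `--supports stmt-QuantumFields-19200 --as helper`; count-neutral.  Nothing of [Balaban1985Variational] is asserted beyond what
✓`Prop7CmapTwSymInputs.inputs_CmapTwS` already proves ((72) `‖(δ∕δA)C‖ ≤ C₃‖A‖`); the rest is counting.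

THE PRINT.  [Balaban1985Variational] p. 289 (72)–(73): «|𝔇(A′; c, b)| ≤ C₃ … » — the kernel of the derivative of `C_k` is small per bond and local; its COARSE COLUMN
`Σ_c |𝔇(A′; c, b)|` is what (86) p. 291 consumes for `W₁`; the cell's carrier is ✓`B11Eq73KernelColumnsCarrier`'s `hCg`∕`hG` (:152∕:155).

WHAT IS PROVED (sorry-free, no definition; data = ✓`inputs_CmapTwS`'s: `0 < ε₀`, `0 < e`, `10⁹L²e ≤ 1`, `10¹²L³ε₀ ≤ 1`, `RegPr F n K ε₀ U₀`; EXPONENT units, route sup norms;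
`C₃ := 40·(2·(3·(2e + 2700Lε₀)))∕(e·η)²`).
* §1 ★`norm_fderiv_CmapTwS_apply_le` — per entry, ANY direction: `‖(fderiv ℂ (CmapTwS U₀) A δ)(c)‖ ≤ C₃·‖A‖·‖δ‖` on `‖A‖ < e·η∕2` (`norm_le_pi_norm` + `le_opNorm` + `deriv_le`).
* §2 counting on the torus `T^{(j)}`: `sum_indicator_src_eq` (`Σ_{c′} 𝟙[c′₋ = z] = d`), `sum_indicator_tgt_eq` (`Σ_{c′} 𝟙[c′₊ = z] = d`, translation is a bijection, ✓`B10StarCount`),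
  hence `sum_indicator_src_or_tgt_le` (`≤ 2d`); transported along ✓`T3LevelShift.bondShift` to the comparison lattice (`Equiv.sum_comp`).
* §3 ★★★`sum_norm_fderiv_CmapTwS_apply_le_of_entry_row` — for a direction `δ` supported on ONE fine bond `bb` (`δ b = 0` for `b ≠ bb`; e.g. `Pi.single bb X`) and ANY per-entry
  letter `M ≥ 0` valid at the `≤ 2d` coarse bonds incident to `B^{K−n}(bb₋)`: `Σ_{c : PBond (F.P n) 0} ‖(fderiv ℂ (CmapTwS U₀) A δ)(c)‖ ≤ 6·M` on `‖A‖ < e·η` (only the coarse bonds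
  `c` with `ĉ₋ = B^{K−n}(bb₋)` or `ĉ₊ = B^{K−n}(bb₋)` can read `bb`, ✓`fderiv_CmapTwS_apply_eq_zero_of_vanish_on_reads`); the per-lattice instance
  `sum_norm_fderiv_CmapTwS_apply_le_of_support` with `M := C₃·‖A‖·‖δ‖` from §1.
HONEST SCOPE (★px3 g2 20:14:25Z caveat, adopted).  §1's operator-norm letter `C₃·‖A‖·‖δ‖` is η-free after the (W-X′) dressing but carries NO single-bond volume factor; the
carriers' product `θ_E = 2·Θ_H·G·ℓ` (✓`colSum_weighted_kernel_fderiv_Emap_le`) is k-uniform only with the (157)-twˢ per-entry letter `M ∝ ‖A‖·L^{−3(K−n)}·‖X‖` ([Balaban1985Averaging]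
Prop. 5 (157); flat twin ✓`B7Prop5General.prop5_general_157`) against `Θ_H ∝ L^{3(K−n)}` — that letter is NOT proved here (it is the displayed input of §3's ★★★); the
per-lattice corollary is recorded for completeness and must NOT be read as the k-uniform `hCg`.  The (W-X′) dressing into `hCg`∕`hG` and `hHk`∕`hH1` (N06) are not in this
file.  Nothing here claims EX, the crux, d = 4 or the mass gap.

References: T. Bałaban, CMP **102** (1985) 277–309 [Balaban1985Variational] ((44) p.285, (72)–(73) p.289, (86) p.291); CMP **98** (1985) 17–51 [Balaban1985Averaging]
((110) p.34, Prop. 5 (157) p.42).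
-/

set_option autoImplicit false

noncomputable section

namespace Summit.QuantumFields.YangMills.Theorems.Prop7CmapTwSCoarseColumn

open scoped Matrix.Norms.L2Operator BigOperators
open NormedSpace Metric Set
open Literature.MathematicalPhysics.QuantumFieldTheory.Balaban1983to89
open Literature.MathematicalPhysics.QuantumFieldTheory.Balaban1983to89.T3ContinuumYM3Torus
open T3PrintedRegularMinimiser (RegPr)
open T3PrintedRegularOrbits (sites_eq)
open T3SectALandauChart (eta eta_pos)
open T3LevelShift (siteShift bondShift bondShift_src bondShift_tgt)
open B5Eq118OneStroke (iterBlockOf)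
open Summit.QuantumFields.YangMills.Theorems.Prop7SymAvgTwSym (CmapTwS)
open Summit.QuantumFields.YangMills.Theorems.Prop7CmapTwSymInputs (inputs_CmapTwS)
open Summit.QuantumFields.YangMills.Theorems.Prop7CmapTwSReadSet (fderiv_CmapTwS_apply_eq_zero_of_vanish_on_reads)

/-! ## §1 Per entry: the derivative bound (72) of ✓`inputs_CmapTwS` read at one coarse bond -/

section Entry

variable (F : T3Family) (n K : ℕ) (h : n ≤ K) {ε₀ e : ℝ} (hε₀ : 0 < ε₀) (he : 0 < e) (hWe : 10 ^ 9 * (F.L : ℝ) ^ 2 * e ≤ 1) (hWε : 10 ^ 12 * (F.L : ℝ) ^ 3 * ε₀ ≤ 1)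
  (U₀ : GaugeField (F.P K) 0 (Matrix.specialUnitaryGroup (Fin 2) ℂ)) (hreg : RegPr F n K ε₀ U₀)

include hε₀ he hWe hWε hreg in
/-- ★ **PER ENTRY, ANY DIRECTION (PER-LATTICE LETTER)**: `‖(fderiv (C(U₀,·)) A δ)(c)‖ ≤ C₃·‖A‖·‖δ‖` on `‖A‖ < e·η∕2` — (72) through the operator norm on the route's sup-normed
carriers (a bond delta `δ = δ_bb·X` costs `‖X‖`, no `η⁻¹`; NO single-bond volume factor `L^{−3(K−n)}` — see HONEST SCOPE). [cite: Balaban1985Variational, (72) p.289, (44) p.285] -/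
theorem norm_fderiv_CmapTwS_apply_le {A : PBond (F.P K) 0 → Matrix (Fin 2) (Fin 2) ℂ} (hA : ‖A‖ < e * eta F n K / 2)
    (δ : PBond (F.P K) 0 → Matrix (Fin 2) (Fin 2) ℂ) (c : PBond (F.P n) 0) :
    ‖fderiv ℂ (CmapTwS F n K h U₀) A δ c‖ ≤ (40 * (2 * (3 * (2 * e + 2700 * (F.L : ℝ) * ε₀))) / (e * eta F n K) ^ 2) * ‖A‖ * ‖δ‖ := by
  have hI := inputs_CmapTwS F h hε₀ he hWe hWε U₀ hreg (B₀ := 0)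
    (H := (0 : (PBond (F.P n) 0 → Matrix (Fin 2) (Fin 2) ℂ) →ₗ[ℂ] (PBond (F.P K) 0 → Matrix (Fin 2) (Fin 2) ℂ)))
    (fun X => by rw [LinearMap.zero_apply, norm_zero, zero_mul])
  have hA' : ‖A‖ < 2 * (e * eta F n K / 4) := by linarith
  have hD := hI.deriv_le A hA'
  calc ‖fderiv ℂ (CmapTwS F n K h U₀) A δ c‖ ≤ ‖fderiv ℂ (CmapTwS F n K h U₀) A δ‖ := norm_le_pi_norm _ c
    _ ≤ ‖fderiv ℂ (CmapTwS F n K h U₀) A‖ * ‖δ‖ := ContinuousLinearMap.le_opNorm _ _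
    _ ≤ (40 * (2 * (3 * (2 * e + 2700 * (F.L : ℝ) * ε₀))) / (e * eta F n K) ^ 2) * ‖A‖ * ‖δ‖ :=
        mul_le_mul_of_nonneg_right hD (norm_nonneg _)

end Entry

/-! ## §2 Counting: at most `2d` bonds of a torus are incident to a given site -/

section Count

variable {P : Params} {j : ℕ}

/-- `Σ_{c} 𝟙[c₋ = z] = d`: the bonds with a given source are one per direction. [folklore] -/
theorem sum_indicator_src_eq (z : Site P j) : ∑ c : PBond P j, (if c.src = z then (1 : ℝ) else 0) = P.d := by
  let eqv : PBond P j ≃ Site P j × Fin P.d := ⟨fun b => (b.src, b.dir), fun p => ⟨p.1, p.2⟩, fun _ => rfl, fun _ => rfl⟩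
  rw [← Fintype.sum_equiv eqv.symm (fun p : Site P j × Fin P.d => if p.1 = z then (1 : ℝ) else 0) _ (fun _ => rfl), Fintype.sum_prod_type_right]
  simp only [Finset.sum_ite_eq', Finset.mem_univ, if_true, Finset.sum_const, Finset.card_univ, Fintype.card_fin, nsmul_eq_mul, mul_one]

/-- `x + e_μ = z ↔ x = z − e_μ` on the torus. [folklore] -/
theorem shift_eq_iff_eq_unshift (x z : Site P j) (μ : Fin P.d) : x.shift μ = z ↔ x = z.unshift μ := by
  constructor
  · intro hx; rw [← hx, B10StarCount.unshift_shift]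
  · intro hx; rw [hx, B10StarCount.shift_unshift]

/-- `Σ_{c} 𝟙[c₊ = z] = d`: the bonds with a given target are one per direction (translation is a bijection). [folklore] -/
theorem sum_indicator_tgt_eq (z : Site P j) : ∑ c : PBond P j, (if c.tgt = z then (1 : ℝ) else 0) = P.d := by
  let eqv : PBond P j ≃ Site P j × Fin P.d := ⟨fun b => (b.src, b.dir), fun p => ⟨p.1, p.2⟩, fun _ => rfl, fun _ => rfl⟩
  rw [← Fintype.sum_equiv eqv.symm (fun p : Site P j × Fin P.d => if p.1.shift p.2 = z then (1 : ℝ) else 0) _ (fun _ => rfl), Fintype.sum_prod_type_right]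
  simp only [shift_eq_iff_eq_unshift, Finset.sum_ite_eq', Finset.mem_univ, if_true, Finset.sum_const, Finset.card_univ, Fintype.card_fin, nsmul_eq_mul, mul_one]

/-- `Σ_{c} (𝟙[c₋ = z] + 𝟙[c₊ = z]) = 2d`. [folklore] -/
theorem sum_indicator_src_add_tgt_eq (z : Site P j) : ∑ c : PBond P j, ((if c.src = z then (1 : ℝ) else 0) + (if c.tgt = z then (1 : ℝ) else 0)) = 2 * P.d := by
  rw [Finset.sum_add_distrib, sum_indicator_src_eq, sum_indicator_tgt_eq, two_mul]

/-- **A NON-NEGATIVE FUNCTION ON THE BONDS SUPPORTED ON THOSE INCIDENT TO `z` AND BOUNDED BY `M` SUMS TO AT MOST `2d·M`.** [folklore] -/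
theorem sum_le_of_support_incident (z : Site P j) {g : PBond P j → ℝ} {M : ℝ} (hM : 0 ≤ M) (hgM : ∀ c, g c ≤ M)
    (hsupp : ∀ c, ¬ (c.src = z ∨ c.tgt = z) → g c = 0) : ∑ c : PBond P j, g c ≤ 2 * P.d * M := by
  have hle : ∀ c : PBond P j, g c ≤ ((if c.src = z then (1 : ℝ) else 0) + (if c.tgt = z then (1 : ℝ) else 0)) * M := by
    intro c
    by_cases hc : c.src = z ∨ c.tgt = z
    · rcases hc with h1 | h1
      · rw [if_pos h1]
        have h2 : 0 ≤ (if c.tgt = z then (1 : ℝ) else 0) := by split_ifs <;> norm_num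
        nlinarith [hgM c]
      · rw [if_pos h1]
        have h2 : 0 ≤ (if c.src = z then (1 : ℝ) else 0) := by split_ifs <;> norm_num
        nlinarith [hgM c]
    · rw [hsupp c hc]
      have h2 : 0 ≤ (if c.src = z then (1 : ℝ) else 0) := by split_ifs <;> norm_num
      have h3 : 0 ≤ (if c.tgt = z then (1 : ℝ) else 0) := by split_ifs <;> norm_num
      positivity
  calc ∑ c : PBond P j, g c ≤ ∑ c : PBond P j, ((if c.src = z then (1 : ℝ) else 0) + (if c.tgt = z then (1 : ℝ) else 0)) * M := Finset.sum_le_sum fun c _ => hle c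
    _ = 2 * P.d * M := by rw [← Finset.sum_mul, sum_indicator_src_add_tgt_eq]

end Count

/-! ## §3 The coarse column of the kernel of `(δ∕δA)C(U₀, A)` -/

section Column

variable (F : T3Family) (n K : ℕ) (h : n ≤ K) {ε₀ e : ℝ} (hε₀ : 0 < ε₀) (he : 0 < e) (hWe : 10 ^ 9 * (F.L : ℝ) ^ 2 * e ≤ 1) (hWε : 10 ^ 12 * (F.L : ℝ) ^ 3 * ε₀ ≤ 1)
  (U₀ : GaugeField (F.P K) 0 (Matrix.specialUnitaryGroup (Fin 2) ℂ)) (hreg : RegPr F n K ε₀ U₀)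

include hε₀ he hWe hWε hreg in
/-- **OFF THE `2d` COARSE BONDS INCIDENT TO `B^{K−n}(bb₋)` THE ENTRY VANISHES**: if `δ` is supported on the fine bond `bb` and neither end of `ĉ = bondShift c` is the
`(K−n)`-block point of `bb₋`, then `(fderiv (C(U₀,·)) A δ)(c) = 0` (the read condition of ✓`Prop7CmapTwSReadSet` fails at `bb`, and `δ` vanishes elsewhere).
[cite: Balaban1985Variational, (72)–(73) p.289; Balaban1985Averaging, (110) p.34] -/
theorem fderiv_CmapTwS_apply_eq_zero_of_support_of_not_incident {A : PBond (F.P K) 0 → Matrix (Fin 2) (Fin 2) ℂ} (hA : ‖A‖ < e * eta F n K)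
    (bb : PBond (F.P K) 0) (δ : PBond (F.P K) 0 → Matrix (Fin 2) (Fin 2) ℂ) (hδ : ∀ b, b ≠ bb → δ b = 0) (c : PBond (F.P n) 0)
    (hc : ¬ ((bondShift (sites_eq F n K h) c).src = iterBlockOf (K - n) bb.src ∨ (bondShift (sites_eq F n K h) c).tgt = iterBlockOf (K - n) bb.src)) :
    fderiv ℂ (CmapTwS F n K h U₀) A δ c = 0 := by
  refine fderiv_CmapTwS_apply_eq_zero_of_vanish_on_reads F n K h hε₀ he hWe hWε U₀ hreg hA δ c fun b hbs _ => ?_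
  by_cases hb : b = bb
  · subst hb
    exact absurd (hbs.elim (fun h1 => Or.inl h1.symm) (fun h1 => Or.inr h1.symm)) hc
  · exact hδ b hb

include hε₀ he hWe hWε hreg in
/-- ★★★ **THE COARSE COLUMN OF `𝔇(A; ·, bb)` FROM ANY PER-ENTRY LETTER**: for a direction `δ` supported on ONE fine bond `bb`, `‖A‖ < e·η`, and any `M ≥ 0` bounding the entries at
the coarse bonds INCIDENT to `B^{K−n}(bb₋)` (`ĉ₋ = B^{K−n}(bb₋)` or `ĉ₊ = B^{K−n}(bb₋)`), `Σ_{c ∈ T^{(n)} bonds} ‖(fderiv (C(U₀,·)) A δ)(c)‖ ≤ 6·M` — `F.m`- and `K`-free count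
`2d = 6`; every other entry vanishes by the read set.  The per-entry letter `M` is the consumer's ((157)-twˢ for the k-uniform `hCg`; §1 per lattice).
[cite: Balaban1985Variational, (72)–(73) p.289, (86) p.291; Balaban1985Averaging, (157) p.42, (110) p.34] -/
theorem sum_norm_fderiv_CmapTwS_apply_le_of_entry_row {A : PBond (F.P K) 0 → Matrix (Fin 2) (Fin 2) ℂ} (hA : ‖A‖ < e * eta F n K)
    (bb : PBond (F.P K) 0) (δ : PBond (F.P K) 0 → Matrix (Fin 2) (Fin 2) ℂ) (hδ : ∀ b, b ≠ bb → δ b = 0) {M : ℝ} (hM : 0 ≤ M)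
    (hrow : ∀ c : PBond (F.P n) 0,
      ((bondShift (sites_eq F n K h) c).src = iterBlockOf (K - n) bb.src ∨ (bondShift (sites_eq F n K h) c).tgt = iterBlockOf (K - n) bb.src) →
      ‖fderiv ℂ (CmapTwS F n K h U₀) A δ c‖ ≤ M) :
    ∑ c : PBond (F.P n) 0, ‖fderiv ℂ (CmapTwS F n K h U₀) A δ c‖ ≤ 6 * M := by
  -- every entry is `≤ M`: on the incident bonds by `hrow`, elsewhere it vanishes
  have hall : ∀ c : PBond (F.P n) 0, ‖fderiv ℂ (CmapTwS F n K h U₀) A δ c‖ ≤ M := by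
    intro c
    by_cases hc : (bondShift (sites_eq F n K h) c).src = iterBlockOf (K - n) bb.src ∨ (bondShift (sites_eq F n K h) c).tgt = iterBlockOf (K - n) bb.src
    · exact hrow c hc
    · rw [fderiv_CmapTwS_apply_eq_zero_of_support_of_not_incident F n K h hε₀ he hWe hWε U₀ hreg hA bb δ hδ c hc, norm_zero]
      exact hM
  -- transport the sum to the comparison lattice `T^{(K)}_{K−n}` along `bondShift` and count
  have hsum : ∑ c : PBond (F.P n) 0, ‖fderiv ℂ (CmapTwS F n K h U₀) A δ c‖ =
      ∑ c' : PBond (F.P K) (K - n), ‖fderiv ℂ (CmapTwS F n K h U₀) A δ ((bondShift (sites_eq F n K h)).symm c')‖ :=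
    Fintype.sum_equiv (bondShift (sites_eq F n K h)) _ _ fun c => by rw [Equiv.symm_apply_apply]
  rw [hsum]
  have hd : ((F.P K).d : ℝ) = 3 := by norm_num [T3Family.P_d]
  have hmain := sum_le_of_support_incident (iterBlockOf (K - n) bb.src)
    (g := fun c' : PBond (F.P K) (K - n) => ‖fderiv ℂ (CmapTwS F n K h U₀) A δ ((bondShift (sites_eq F n K h)).symm c')‖) hM
    (fun c' => hall _)
    (fun c' hc' => by
      show ‖fderiv ℂ (CmapTwS F n K h U₀) A δ ((bondShift (sites_eq F n K h)).symm c')‖ = 0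
      rw [fderiv_CmapTwS_apply_eq_zero_of_support_of_not_incident F n K h hε₀ he hWe hWε U₀ hreg hA bb δ hδ _
        (by rwa [Equiv.apply_symm_apply]), norm_zero])
  rw [hd] at hmain
  linarith

include hε₀ he hWe hWε hreg in
/-- **THE PER-LATTICE COLUMN** (§1's operator-norm letter as `M`): for `δ` supported on one fine bond and `‖A‖ < e·η∕2`,
`Σ_c ‖(fderiv (C(U₀,·)) A δ)(c)‖ ≤ 6·(C₃·‖A‖·‖δ‖)` — correct, `F.m`-∕`K`-free as a COUNT, but WITHOUT the single-bond volume factor (HONEST SCOPE: not the k-uniform `hCg`).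
[cite: Balaban1985Variational, (72)–(73) p.289] -/
theorem sum_norm_fderiv_CmapTwS_apply_le_of_support {A : PBond (F.P K) 0 → Matrix (Fin 2) (Fin 2) ℂ} (hA : ‖A‖ < e * eta F n K / 2)
    (bb : PBond (F.P K) 0) (δ : PBond (F.P K) 0 → Matrix (Fin 2) (Fin 2) ℂ) (hδ : ∀ b, b ≠ bb → δ b = 0) :
    ∑ c : PBond (F.P n) 0, ‖fderiv ℂ (CmapTwS F n K h U₀) A δ c‖ ≤
      6 * ((40 * (2 * (3 * (2 * e + 2700 * (F.L : ℝ) * ε₀))) / (e * eta F n K) ^ 2) * ‖A‖ * ‖δ‖) := by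
  have hη := eta_pos F n K
  have hA1 : ‖A‖ < e * eta F n K := by nlinarith [norm_nonneg A, mul_pos he hη]
  have hM : 0 ≤ (40 * (2 * (3 * (2 * e + 2700 * (F.L : ℝ) * ε₀))) / (e * eta F n K) ^ 2) * ‖A‖ * ‖δ‖ := by positivity
  exact sum_norm_fderiv_CmapTwS_apply_le_of_entry_row F n K h hε₀ he hWe hWε U₀ hreg hA1 bb δ hδ hM
    fun c _ => norm_fderiv_CmapTwS_apply_le F n K h hε₀ he hWe hWε U₀ hreg hA δ c

end Column

end Summit.QuantumFields.YangMills.Theorems.Prop7CmapTwSCoarseColumn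

end
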